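import Mathlib
import Literature.MathematicalPhysics.QuantumFieldTheory.Balaban1983to89.B5ToronEq190

/-!
# B5 Prop. 1.1 (1.90) AT A CONSTANT ABELIAN BACKGROUND ("TORON TWINS", fifth file): the bound from below
# `Δ^ω_a ≥ γ(d,a)·(Δ_ω + I)` for a UNIT TWIST `ω = e^{iφ}`, unconditionally — the re-centring bookkeeping

statement-level skeleton of published theorems with citation tags; proofs where landed; nothing here is a claim
about the Yang–Mills mass gap

Sources.  T. Bałaban, *Propagators and renormalization transformations for lattice gauge theories. I*, Commun.
Math. Phys. **95** (1984) 17–40 [Balaban1984PropagatorsI] ("B5"): (1.31) p. 23, (1.73) p. 30, (1.83) p. 31,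
Prop. 1.1 (1.89)/(1.90) p. 33.  T. Bałaban, *Propagators for lattice gauge theories in a background field*,
Commun. Math. Phys. **99** (1985) 389–434 [Balaban1985BackgroundPropagators] ("B9"): (3.26) p. 395, Thm 3.11 p. 416.

## What the papers print (verbatim)

[B5] p. 33: «This implies the bound from below: Δ_a = G⁻¹ ≥ γ₀(Δ + I). (1.90)»; p. 23: «p ∈ T̃_η is represented
as a sum p = p′ + l».  [B9] p. 395, on `Δ_a(U)` (3.26): «It coincides with Δ_a … if U = 1».

## What this module certifies (kernel-checked, 0 `sorry`)

The three displayed hypotheses of `B5ToronEq190.b05Tw_form_lower` (inverse blocks, their positivity, their four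
(1.89) sandwich bounds) DISCHARGED at every unit twist `ω = twistOf φ`, `φ ∈ ℝ^d` arbitrary:
* §1 `DaTw ω p′` — the explicit Fourier block of the twisted `Δ^ω_a` on the coset of `p′` (any twist), and
  `DeltaATw_eq_blockOp : Δ^ω_a = blockOp (DaTw ω)` ((1.73)^ω at operator level, from `B5ToronDeltaA169.fiber_DeltaATw`).
* §2 PERIODICITY: Bałaban's functions `∂_μ(s+l)`, `Δ(s+l)`, `∂¹_μ(s)`, `v_μ`, `u` of (1.31)/(1.61) are unchanged
  under `(s, l) ↦ (s − 2πm, l + m mod n)` (`dSym_recentre`, `Delta_recentre`, `d1Sym_recentre`, `vSym_recentre`,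
  `uSym_recentre`).
* §3 RE-CENTRING of the shifted momentum `s′ = p′ + nφ` of `B5ToronMomentum161.sOfTw`: `s″ = reS ∈ (−π, π]^d`,
  `s′ = s″ + 2π(m̄ + n t)` (`reS_spec`), so every twisted symbol on the coset of `p′` at offset `l` is the flat
  symbol at `(s″, l + m̄)` (`ssymTw_twistOf_re`, `lsymTw_twistOf_re`, `uTw_twistOf_re`, `vTw_twistOf_re`,
  `XsTw_twistOf_re`).
* §4 THE BLOCKS: `DaTw (twistOf φ) p′` is pass 5's fiber `Da (balabanFiber n hn a ha s″ …)` (`s″ ≠ 0`), resp. B5's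
  `p′ = 0` fiber `Da₀` (`s″ = 0`), conjugated by the offset shift `l ↦ l + m̄` (`DaTw_twistOf_eq_of_ne/_of_eq`);
  hence the inverse blocks `GTw` (= (1.83) at `s″`, resp. `G₀`, shifted) satisfy `DaTw·GTw = 1`, `GTw ≥ 0`, and
  the four (1.89) sandwich bounds `≤ Cst(d,a)` with the twisted weights (`GTw_sandwich_le`, from
  `B5Prop11Fiber.opNorm_sandwich_G_le_of_orders` / `B5Prop11Plancherel.opNorm_sandwich_G₀_le_of_orders`).
* §5 **`b05Tw_form_lower_twistOf`**: for every `n ≥ 1`, `a > 0`, every volume `M` and EVERY phase vector `φ`,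
  `(1/((d+1)·Cst(d,a)))·Σ_w‖A w‖² ≤ re⟨A, Δ^{e^{iφ}}_a A⟩` — the twisted (1.90) with the flat, volume-free constant;
  at `φ = 0` it re-derives `B5Eq190FlatCoercivityUniform.b05_form_lower` (`b05_form_lower_recovered`).

HONEST SCOPE.  (H1) constant ABELIAN backgrounds only (torons `ω_ν = e^{iφ_ν}`), i.e. the `U(1)`-reduction of
[B9]'s `Δ_a(U)` at a flat `U`; non-abelian constant backgrounds and non-constant `U` are NOT treated.  (H2) the
constant is OURS (`Cst(d,a)` of pass 4), the paper prints none.  (H3) 0 `instance`, 0 `notation`, 0 new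
`def … : Prop`; NOT summit progress (rung R3 of `ym3-torus` is YM₃ on T³ — not d = 4, not a mass gap, not Clay).
-/

open scoped BigOperators Matrix ComplexConjugate ComplexOrder Matrix.Norms.L2Operator
open Finset Complex

namespace Literature.MathematicalPhysics.QuantumFieldTheory.Balaban1983to89.B5ToronEq190UnitTwist

open Literature.MathematicalPhysics.QuantumFieldTheory.Balaban1983to89.B4Strip
open Literature.MathematicalPhysics.QuantumFieldTheory.Balaban1983to89.B5Prop11Leaves
open Literature.MathematicalPhysics.QuantumFieldTheory.Balaban1983to89.B5Prop11Bound
open Literature.MathematicalPhysics.QuantumFieldTheory.Balaban1983to89.B5Prop11Fiber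
open Literature.MathematicalPhysics.QuantumFieldTheory.Balaban1983to89.B5Prop11Plancherel
open Literature.MathematicalPhysics.QuantumFieldTheory.Balaban1983to89.B5Prop11Inverse
open Literature.MathematicalPhysics.QuantumFieldTheory.Balaban1983to89.B5Prop11Lower
open Literature.MathematicalPhysics.QuantumFieldTheory.Balaban1983to89.B5Action121
open Literature.MathematicalPhysics.QuantumFieldTheory.Balaban1983to89.B5Block118
open Literature.MathematicalPhysics.QuantumFieldTheory.Balaban1983to89.B5FiberZero
open Literature.MathematicalPhysics.QuantumFieldTheory.Balaban1983to89.B5LaplaceInverse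
open Literature.MathematicalPhysics.QuantumFieldTheory.Balaban1983to89.B5DeltaA169
open Literature.MathematicalPhysics.QuantumFieldTheory.Balaban1983to89.B5ToronOperators118
open Literature.MathematicalPhysics.QuantumFieldTheory.Balaban1983to89.B5ToronMomentum161
open Literature.MathematicalPhysics.QuantumFieldTheory.Balaban1983to89.B5ToronDeltaA169
open Literature.MathematicalPhysics.QuantumFieldTheory.Balaban1983to89.B5ToronEq190

noncomputable section

/-! ## §1 The explicit Fourier blocks of the twisted `Δ_a` (any twist) -/

section Blocks

variable {d : ℕ} (n : ℕ) [NeZero n] (M : Fin d → ℕ) [hM : ∀ μ, NeZero (M μ)] (a : ℝ) (ω : Fin d → ℂ)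

/-- THE FOURIER BLOCK OF THE TWISTED `Δ^ω_a` ON THE COSET OF `p′` (index `(l, κ)`), any twist `ω`:
`[l = l′][κ = κ′]·lsymTw(p′+l) − ssymTw_κ(p′+l)·\overline{uTw(p′+l)}/(lsymTw(p′+l)·XsTw(p′))·uTw(p′+l′)·
\overline{ssymTw_{κ′}(p′+l′)}/lsymTw(p′+l′) + [κ = κ′]·a·\overline{(uTw vTw_κ)(p′+l)}(uTw vTw_κ)(p′+l′)`
— (1.73) with the twisted letters (the coefficients of `B5ToronDeltaA169.fiber_DeltaATw`).
[cite: Balaban1984PropagatorsI, (1.73) p.30, (1.83) p.31; Balaban1985BackgroundPropagators, (3.26) p.395] -/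
def DaTw (q : Tor M) : Matrix ((Fin d → Fin n) × Fin d) ((Fin d → Fin n) × Fin d) ℂ := fun i j =>
  (if i = j then lsymTw (fine n M) (n : ℂ) ω (pOf n M (i.1, q)) else 0)
    - ssymTw (fine n M) (n : ℂ) ω i.2 (pOf n M (i.1, q))
        * ((lsymTw (fine n M) (n : ℂ) ω (pOf n M (i.1, q)))⁻¹ * conj (uTw n M ω i.1 q)
          * (XsTw n M (n : ℂ) ω q)⁻¹)
        * (uTw n M ω j.1 q * ((lsymTw (fine n M) (n : ℂ) ω (pOf n M (j.1, q)))⁻¹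
          * conj (ssymTw (fine n M) (n : ℂ) ω j.2 (pOf n M (j.1, q)))))
    + (if i.2 = j.2 then
        (a : ℂ) * (conj (uTw n M ω i.1 q * vTw n M ω i.1 q i.2) * (uTw n M ω j.1 q * vTw n M ω j.1 q i.2))
      else 0)

/-- the block acts as the right-hand side of `fiber_DeltaATw`. [cite: Balaban1984PropagatorsI, (1.73) p.30] -/
theorem DaTw_mulVec (q : Tor M) (V : (Fin d → Fin n) × Fin d → ℂ) (k : Fin d → Fin n) (κ : Fin d) :
    (DaTw n M a ω q *ᵥ V) (k, κ)
      = lsymTw (fine n M) (n : ℂ) ω (pOf n M (k, q)) * V (k, κ)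
        - ssymTw (fine n M) (n : ℂ) ω κ (pOf n M (k, q))
          * ((lsymTw (fine n M) (n : ℂ) ω (pOf n M (k, q)))⁻¹ * conj (uTw n M ω k q)
            * (XsTw n M (n : ℂ) ω q)⁻¹
            * ∑ k' : Fin d → Fin n, uTw n M ω k' q
              * ((lsymTw (fine n M) (n : ℂ) ω (pOf n M (k', q)))⁻¹
                * ∑ ν, conj (ssymTw (fine n M) (n : ℂ) ω ν (pOf n M (k', q))) * V (k', ν)))
        + (a : ℂ) * (conj (uTw n M ω k q * vTw n M ω k q κ) *
            ∑ k' : Fin d → Fin n, uTw n M ω k' q * vTw n M ω k' q κ * V (k', κ)) := by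
  simp only [Matrix.mulVec, dotProduct, DaTw]
  simp only [add_mul, sub_mul, Finset.sum_add_distrib, Finset.sum_sub_distrib]
  congr 1
  · congr 1
    · simp only [ite_mul, zero_mul, Finset.sum_ite_eq, Finset.mem_univ, if_true]
    · rw [Fintype.sum_prod_type]
      simp only [Finset.mul_sum]
      exact Finset.sum_congr rfl fun k' _ => Finset.sum_congr rfl fun ν _ => by ring
  · rw [Fintype.sum_prod_type]
    simp only [ite_mul, zero_mul, Finset.sum_ite_eq, Finset.mem_univ, if_true, Finset.mul_sum]
    exact Finset.sum_congr rfl fun k' _ => by ring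

/-- **(1.73)^ω AT OPERATOR LEVEL: `Δ^ω_a = U^*·(DaTw ω, block-diagonal over the cosets)·U`**, any twist.
[cite: Balaban1984PropagatorsI, (1.73) p.30, (1.83) p.31; Balaban1985BackgroundPropagators, (3.26) p.395] -/
theorem DeltaATw_eq_blockOp : DeltaATw n M a ω = blockOp n M (DaTw n M a ω) :=
  eq_blockOp_of_fiber n M _ _ fun A k q κ => by
    rw [fiber_DeltaATw, DaTw_mulVec]

end Blocks

/-! ## §2 Periodicity of Bałaban's functions under `(s, l) ↦ (s − 2πm, l + m mod n)` -/

section Recentre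

variable {d : ℕ} (n : ℕ) [NeZero n] (s' s'' : Fin d → ℝ) (mbar : Fin d → Fin n) (t : Fin d → ℤ)
  (hrec : ∀ μ, s' μ = s'' μ + 2 * Real.pi * (((mbar μ : ℕ) : ℝ) + (n : ℝ) * (t μ : ℝ)))

/-- `e^{i(x − 2πz)} = e^{ix}`. [cite: Balaban1984PropagatorsI, (1.31) p.23] -/
theorem exp_mul_I_sub_two_pi_mul (x : ℝ) (z : ℤ) :
    Complex.exp (((x - 2 * Real.pi * (z : ℝ) : ℝ) : ℂ) * I) = Complex.exp ((x : ℂ) * I) := by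
  have h : ((x - 2 * Real.pi * (z : ℝ) : ℝ) : ℂ) * I = (x : ℂ) * I + ((-z : ℤ) : ℂ) * (2 * Real.pi * I) := by
    push_cast
    ring
  rw [h, Complex.exp_add, Complex.exp_int_mul_two_pi_mul_I, mul_one]

include hrec in
/-- the shifted momentum in units of `η`: `(s″ + 2π(l+m̄ mod n))/n = (s′ + 2πl)/n − 2π·integer`.
[cite: Balaban1984PropagatorsI, (1.31) p.23] -/
theorem shiftr_recentre (k : Fin d → Fin n) (μ : Fin d) :
    shiftr n (k + mbar) s'' μ / n
      = shiftr n k s' μ / n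
        - 2 * Real.pi * ((t μ + ((((k μ : ℕ) + (mbar μ : ℕ)) / n : ℕ) : ℤ) : ℤ) : ℝ) := by
  have hn : (n : ℝ) ≠ 0 := by exact_mod_cast NeZero.ne n
  have hmod : ((((k + mbar) μ : Fin n) : ℕ) : ℝ)
      = ((k μ : ℕ) : ℝ) + ((mbar μ : ℕ) : ℝ) - (n : ℝ) * (((((k μ : ℕ) + (mbar μ : ℕ)) / n : ℕ)) : ℝ) := by
    have h1 : (((k + mbar) μ : Fin n) : ℕ) = ((k μ : ℕ) + (mbar μ : ℕ)) % n := by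
      rw [Pi.add_apply, Fin.val_add]
    have h2 := Nat.mod_add_div ((k μ : ℕ) + (mbar μ : ℕ)) n
    have h3 : (((((k μ : ℕ) + (mbar μ : ℕ)) % n : ℕ)) : ℝ)
        + (n : ℝ) * (((((k μ : ℕ) + (mbar μ : ℕ)) / n : ℕ)) : ℝ) = ((k μ : ℕ) : ℝ) + ((mbar μ : ℕ) : ℝ) := by
      exact_mod_cast h2
    rw [h1]
    linarith
  simp only [shiftr]
  rw [hmod, hrec μ, Int.cast_add, Int.cast_natCast]
  field_simp
  ring

include hrec in
/-- `e^{iη(s″_μ + 2π(l+m̄)_μ)} = e^{iη(s′_μ + 2πl_μ)}`. [cite: Balaban1984PropagatorsI, (1.31) p.23] -/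
theorem om_recentre (k : Fin d → Fin n) (μ : Fin d) : om n (k + mbar) s'' μ = om n k s' μ := by
  rw [om, om, shiftr_recentre n s' s'' mbar t hrec k μ, exp_mul_I_sub_two_pi_mul]

include hrec in
/-- `∂_μ(s″ + (l+m̄)) = ∂_μ(s′ + l)`. [cite: Balaban1984PropagatorsI, (1.31) p.23] -/
theorem dSym_recentre (k : Fin d → Fin n) (μ : Fin d) : dSym n (k + mbar) s'' μ = dSym n k s' μ := by
  rw [dSym_eq_om, dSym_eq_om, om_recentre n s' s'' mbar t hrec]

include hrec in
/-- `Δ(s″ + (l+m̄)) = Δ(s′ + l)`. [cite: Balaban1984PropagatorsI, (1.31) p.23] -/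
theorem Delta_recentre (k : Fin d → Fin n) :
    DeltaXir n 0 (shiftr n (k + mbar) s'') = DeltaXir n 0 (shiftr n k s') := by
  rw [Delta_eq, Delta_eq]
  simp_rw [dSym_recentre n s' s'' mbar t hrec]

include hrec in
omit [NeZero n] in
/-- `∂¹_μ(s″) = ∂¹_μ(s′)`. [cite: Balaban1984PropagatorsI, (1.31) p.23] -/
theorem d1Sym_recentre (μ : Fin d) : d1Sym s'' μ = d1Sym s' μ := by
  have h : s'' μ = s' μ - 2 * Real.pi * ((((mbar μ : ℕ) : ℤ) + (n : ℤ) * t μ : ℤ) : ℝ) := by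
    have := hrec μ
    push_cast
    linarith
  rw [d1Sym, d1Sym, h, exp_mul_I_sub_two_pi_mul]

include hrec in
/-- `v_μ(s″ + (l+m̄)) = v_μ(s′ + l)`. [cite: Balaban1984PropagatorsI, (1.61) p.28] -/
theorem vSym_recentre (k : Fin d → Fin n) (μ : Fin d) : vSym n (k + mbar) s'' μ = vSym n k s' μ := by
  unfold vSym
  rw [dSym_recentre n s' s'' mbar t hrec, d1Sym_recentre n s' s'' mbar t hrec]

include hrec in
/-- `u(s″ + (l+m̄)) = u(s′ + l)`. [cite: Balaban1984PropagatorsI, (1.31) p.23] -/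
theorem uSym_recentre (k : Fin d → Fin n) : uSym n (k + mbar) s'' = uSym n k s' := by
  unfold uSym
  exact Finset.prod_congr rfl fun μ _ => vSym_recentre n s' s'' mbar t hrec k μ

end Recentre

/-! ## §3 Re-centring the shifted momentum `s′ = p′ + nφ` of a coset into `(−π, π]^d` -/

section Coset

variable {d : ℕ} (n : ℕ) [NeZero n] (M : Fin d → ℕ) [hM : ∀ μ, NeZero (M μ)] (φ : Fin d → ℝ)

/-- the integer vector `m(p′)` with `s′ − 2πm ∈ (−π, π]^d`. [cite: Balaban1984PropagatorsI, (1.31) p.23] -/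
def mQ (q : Tor M) : Fin d → ℤ := fun μ => toIocDiv Real.two_pi_pos (-Real.pi) (sOfTw n M φ q μ)

/-- the re-centred shifted momentum `s″ = s′ − 2πm ∈ (−π, π]^d`. [cite: Balaban1984PropagatorsI, (1.31) p.23] -/
def reS (q : Tor M) : Fin d → ℝ := fun μ => toIocMod Real.two_pi_pos (-Real.pi) (sOfTw n M φ q μ)

omit [NeZero n] hM in
/-- `|s″_μ| ≤ π`. [cite: Balaban1984PropagatorsI, (1.31) p.23] -/
theorem abs_reS_le (q : Tor M) (μ : Fin d) : |reS n M φ q μ| ≤ Real.pi := by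
  have h := toIocMod_mem_Ioc Real.two_pi_pos (-Real.pi) (sOfTw n M φ q μ)
  rw [reS, abs_le]
  exact ⟨h.1.le, by linarith [h.2]⟩

omit [NeZero n] hM in
/-- `s′ = s″ + 2πm`. [cite: Balaban1984PropagatorsI, (1.31) p.23] -/
theorem sOfTw_eq_reS (q : Tor M) (μ : Fin d) :
    sOfTw n M φ q μ = reS n M φ q μ + 2 * Real.pi * (mQ n M φ q μ : ℝ) := by
  have h := toIocMod_add_toIocDiv_zsmul Real.two_pi_pos (-Real.pi) (sOfTw n M φ q μ)
  rw [zsmul_eq_mul] at h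
  rw [reS, mQ]
  linarith

/-- the offset shift `m̄ = m mod n ∈ (ℤ/n)^d`. [cite: Balaban1984PropagatorsI, (1.31) p.23] -/
def mbarQ (q : Tor M) : Fin d → Fin n := fun μ => ⟨ZMod.val ((mQ n M φ q μ : ℤ) : ZMod n), ZMod.val_lt _⟩

/-- the integer quotient `t = ⌊m/n⌋`. [cite: Balaban1984PropagatorsI, (1.31) p.23] -/
def tQ (q : Tor M) : Fin d → ℤ := fun μ => mQ n M φ q μ / n

omit hM in
/-- `m = m̄ + n t`. [cite: Balaban1984PropagatorsI, (1.31) p.23] -/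
theorem mQ_split (q : Tor M) (μ : Fin d) :
    (mQ n M φ q μ : ℤ) = ((mbarQ n M φ q μ : ℕ) : ℤ) + (n : ℤ) * tQ n M φ q μ := by
  have h1 : (((mbarQ n M φ q μ : ℕ)) : ℤ) = mQ n M φ q μ % n := by
    show ((ZMod.val ((mQ n M φ q μ : ℤ) : ZMod n) : ℕ) : ℤ) = _
    exact ZMod.val_intCast _
  rw [h1, tQ]
  exact (Int.emod_add_mul_ediv _ _).symm

omit hM in
/-- THE RE-CENTRING: `s′_μ = s″_μ + 2π(m̄_μ + n t_μ)`. [cite: Balaban1984PropagatorsI, (1.31) p.23] -/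
theorem reS_spec (q : Tor M) (μ : Fin d) :
    sOfTw n M φ q μ
      = reS n M φ q μ + 2 * Real.pi * (((mbarQ n M φ q μ : ℕ) : ℝ) + (n : ℝ) * (tQ n M φ q μ : ℝ)) := by
  rw [sOfTw_eq_reS]
  have h := mQ_split n M φ q μ
  have h' : ((mQ n M φ q μ : ℤ) : ℝ) = ((mbarQ n M φ q μ : ℕ) : ℝ) + (n : ℝ) * (tQ n M φ q μ : ℝ) := by
    exact_mod_cast h
  rw [h']

/-! ### the twisted symbols on the coset of `p′` are the flat ones at `(s″, l + m̄)` -/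

/-- `ssymTw_ν(p′+l) = ∂_ν(s″ + (l+m̄))`. [cite: Balaban1984PropagatorsI, (1.31) p.23, (1.83) p.31] -/
theorem ssymTw_twistOf_re (k : Fin d → Fin n) (q : Tor M) (ν : Fin d) :
    ssymTw (fine n M) (n : ℂ) (twistOf φ) ν (pOf n M (k, q))
      = dSym n (k + mbarQ n M φ q) (reS n M φ q) ν := by
  rw [ssymTw_pOf_twistOf]
  exact (dSym_recentre n _ _ _ _ (reS_spec n M φ q) k ν).symm

/-- `lsymTw(p′+l) = Δ(s″ + (l+m̄))`. [cite: Balaban1984PropagatorsI, (1.31) p.23] -/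
theorem lsymTw_twistOf_re (k : Fin d → Fin n) (q : Tor M) :
    lsymTw (fine n M) (n : ℂ) (twistOf φ) (pOf n M (k, q))
      = ((DeltaXir n 0 (shiftr n (k + mbarQ n M φ q) (reS n M φ q)) : ℝ) : ℂ) := by
  rw [lsymTw_pOf_twistOf, Delta_recentre n _ _ _ _ (reS_spec n M φ q) k]

omit hM in
/-- `uTw(p′+l) = u(s″ + (l+m̄))`. [cite: Balaban1984PropagatorsI, (1.31) p.23] -/
theorem uTw_twistOf_re (k : Fin d → Fin n) (q : Tor M) :
    uTw n M (twistOf φ) k q = uSym n (k + mbarQ n M φ q) (reS n M φ q) := by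
  rw [uTw_twistOf, uSym_recentre n _ _ _ _ (reS_spec n M φ q) k]

omit hM in
/-- `vTw_μ(p′+l) = v_μ(s″ + (l+m̄))`. [cite: Balaban1984PropagatorsI, (1.61) p.28] -/
theorem vTw_twistOf_re (k : Fin d → Fin n) (q : Tor M) (μ : Fin d) :
    vTw n M (twistOf φ) k q μ = vSym n (k + mbarQ n M φ q) (reS n M φ q) μ := by
  rw [vTw_twistOf, vSym_recentre n _ _ _ _ (reS_spec n M φ q) k μ]

/-- `XsTw(p′) = X(s″) = Σ_l |u(s″+l)|²/Δ(s″+l)²` (the sum over offsets re-indexed by `l ↦ l + m̄`).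
[cite: Balaban1984PropagatorsI, (1.33) p.23, (1.83) p.31] -/
theorem XsTw_twistOf_re (q : Tor M) :
    XsTw n M (n : ℂ) (twistOf φ) q
      = ∑ k : Fin d → Fin n, uSym n k (reS n M φ q) * conj (uSym n k (reS n M φ q))
          * ((((DeltaXir n 0 (shiftr n k (reS n M φ q))) : ℝ) : ℂ)⁻¹) ^ 2 := by
  rw [XsTw]
  simp_rw [uTw_twistOf_re, lsymTw_twistOf_re]
  exact Fintype.sum_equiv (Equiv.addRight (mbarQ n M φ q)) _ _ fun k => rfl

end Coset

/-! ## §4 The blocks at a unit twist: pass 5's fibers at `s″`, shifted by `m̄` -/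

section Shift

variable {d : ℕ} (n : ℕ) [NeZero n]

/-- the offset shift `(l, κ) ↦ (l + m̄, κ)` as a permutation of the block index.
[cite: Balaban1984PropagatorsI, (1.31) p.23] -/
def shiftEquiv (m : Fin d → Fin n) : (Fin d → Fin n) × Fin d ≃ (Fin d → Fin n) × Fin d where
  toFun i := (i.1 + m, i.2)
  invFun i := (i.1 - m, i.2)
  left_inv i := by simp
  right_inv i := by simp

/-- `shiftEquiv m (l, κ) = (l + m, κ)`. [cite: Balaban1984PropagatorsI, (1.31) p.23] -/
@[simp] theorem shiftEquiv_apply (m : Fin d → Fin n) (i : (Fin d → Fin n) × Fin d) :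
    shiftEquiv n m i = (i.1 + m, i.2) := rfl

/-- a sandwich of a shifted block by shifted weights is the shifted sandwich.
[cite: Balaban1984PropagatorsI, Prop. 1.1 (1.89) p.33] -/
theorem sandwich_submatrix (m : Fin d → Fin n) (w₁ w₂ : (Fin d → Fin n) → ℂ)
    (A : Matrix ((Fin d → Fin n) × Fin d) ((Fin d → Fin n) × Fin d) ℂ) :
    sandwich (fun k => w₁ (k + m)) (fun k => w₂ (k + m)) (A.submatrix (shiftEquiv n m) (shiftEquiv n m))
      = (sandwich w₁ w₂ A).submatrix (shiftEquiv n m) (shiftEquiv n m) := by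
  ext i j
  rfl

/-- the operator norm is invariant under the shift. [cite: Balaban1984PropagatorsI, Prop. 1.1 (1.89) p.33] -/
theorem norm_submatrix_shiftEquiv (m : Fin d → Fin n)
    (A : Matrix ((Fin d → Fin n) × Fin d) ((Fin d → Fin n) × Fin d) ℂ) :
    ‖A.submatrix (shiftEquiv n m) (shiftEquiv n m)‖ = ‖A‖ := by
  have h : A.submatrix (shiftEquiv n m) (shiftEquiv n m)
      = Matrix.reindex (shiftEquiv n m).symm (shiftEquiv n m).symm A := by
    rw [Matrix.reindex_apply, Equiv.symm_symm]
  rw [h, opNorm_reindex]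

end Shift

section Fibers

variable {d : ℕ}

/-- pass 5's fiber `Δ_a(p′)` (1.73) entrywise: `[l=l′][μ=ν]Δ − ∂_μ\bar u/(ΔX)·u′\bar∂′_ν/Δ′ + [μ=ν]a·\overline{uv_μ}(uv_μ)′`.
[cite: Balaban1984PropagatorsI, (1.73) p.30, (1.83) p.31] -/
theorem Da_apply_explicit {Λ : Type*} [Fintype Λ] [DecidableEq Λ] (F : Fiber Λ d) (i j : Λ × Fin d) :
    Da F i j
      = (if i = j then ((F.Δ i.1 : ℝ) : ℂ) else 0)
        - F.e i.2 i.1 * ((((F.Δ i.1 : ℝ) : ℂ))⁻¹ * conj (F.u i.1) * (((F.X : ℝ) : ℂ))⁻¹)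
            * (F.u j.1 * ((((F.Δ j.1 : ℝ) : ℂ))⁻¹ * conj (F.e j.2 j.1)))
        + (if i.2 = j.2 then
            ((F.a : ℝ) : ℂ) * (conj (F.u i.1 * F.v i.2 i.1) * (F.u j.1 * F.v i.2 j.1))
          else 0) := by
  rw [Da_eq]
  simp only [Matrix.sub_apply, Matrix.smul_apply, Matrix.vecMulVec_apply, Pi.star_apply, Dmat, qv, cv,
    smul_eq_mul, Complex.star_def, map_mul, map_div₀, Complex.conj_conj, Complex.conj_ofReal]
  by_cases h2 : i.2 = j.2
  · by_cases h1 : i.1 = j.1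
    · have hij : i = j := Prod.ext h1 h2
      subst hij
      simp only [if_true]
      ring
    · have hij : i ≠ j := fun h => h1 (congrArg Prod.fst h)
      simp only [h2, h1, hij, if_true, if_false]
      ring
  · have hij : i ≠ j := fun h => h2 (congrArg Prod.snd h)
    simp only [h2, hij, if_false]
    ring

variable (n : ℕ) [NeZero n] (hn : 1 ≤ n) (M : Fin d → ℕ) [hM : ∀ μ, NeZero (M μ)] (a : ℝ) (ha : 0 < a)
  (φ : Fin d → ℝ)

section FiberFields

variable (s : Fin d → ℝ) (hs : ∀ μ, |s μ| ≤ Real.pi) (hs0 : s ≠ 0)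

/-- field `Δ` of pass 5's fiber. [cite: Balaban1984PropagatorsI, (1.31) p.23] -/
theorem balabanFiber_Δ (k : Fin d → Fin n) :
    (balabanFiber n hn a ha s hs hs0).Δ k = DeltaXir n 0 (shiftr n k s) := rfl

/-- field `e` of pass 5's fiber. [cite: Balaban1984PropagatorsI, (1.31) p.23] -/
theorem balabanFiber_e (μ : Fin d) (k : Fin d → Fin n) :
    (balabanFiber n hn a ha s hs hs0).e μ k = dSym n k s μ := rfl

/-- field `u` of pass 5's fiber. [cite: Balaban1984PropagatorsI, (1.31) p.23] -/
theorem balabanFiber_u (k : Fin d → Fin n) : (balabanFiber n hn a ha s hs hs0).u k = uSym n k s := rfl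

/-- field `v` of pass 5's fiber. [cite: Balaban1984PropagatorsI, (1.61) p.28] -/
theorem balabanFiber_v (μ : Fin d) (k : Fin d → Fin n) :
    (balabanFiber n hn a ha s hs hs0).v μ k = vSym n k s μ := rfl

/-- field `a` of pass 5's fiber. [cite: Balaban1984PropagatorsI, (1.69) p.29] -/
theorem balabanFiber_a : (balabanFiber n hn a ha s hs hs0).a = a := rfl

/-- `X(s)` of pass 5's fiber as a complex sum. [cite: Balaban1984PropagatorsI, (1.83) p.31] -/
theorem balabanFiber_X_cast :
    (((balabanFiber n hn a ha s hs hs0).X : ℝ) : ℂ)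
      = ∑ k : Fin d → Fin n, uSym n k s * conj (uSym n k s)
          * ((((DeltaXir n 0 (shiftr n k s)) : ℝ) : ℂ)⁻¹) ^ 2 := by
  rw [X_cast]
  refine Finset.sum_congr rfl fun l _ => ?_
  rw [div_eq_mul_inv, inv_pow]
  rfl

end FiberFields

/-- ★ A NON-DEGENERATE COSET (`s″ ≠ 0`): the block of `Δ^{e^{iφ}}_a` is pass 5's fiber (1.73) at `s″`, shifted by `m̄`.
[cite: Balaban1984PropagatorsI, (1.73) p.30, (1.83) p.31; Balaban1985BackgroundPropagators, (3.26) p.395] -/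
theorem DaTw_twistOf_apply_of_ne (q : Tor M) (h0 : reS n M φ q ≠ 0) (i j : (Fin d → Fin n) × Fin d) :
    DaTw n M a (twistOf φ) q i j
      = Da (balabanFiber n hn a ha (reS n M φ q) (abs_reS_le n M φ q) h0)
          (shiftEquiv n (mbarQ n M φ q) i) (shiftEquiv n (mbarQ n M φ q) j) := by
  have hX : XsTw n M (n : ℂ) (twistOf φ) q
      = (((balabanFiber n hn a ha (reS n M φ q) (abs_reS_le n M φ q) h0).X : ℝ) : ℂ) := by
    rw [balabanFiber_X_cast, XsTw_twistOf_re]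
  rw [Da_apply_explicit]
  simp only [EmbeddingLike.apply_eq_iff_eq]
  simp only [DaTw, ssymTw_twistOf_re, lsymTw_twistOf_re, uTw_twistOf_re, vTw_twistOf_re, hX,
    shiftEquiv_apply, balabanFiber_Δ, balabanFiber_e, balabanFiber_u, balabanFiber_v, balabanFiber_a]

/-- `∂_μ(0 + 0) = 0`. [cite: Balaban1984PropagatorsI, (1.31) p.23] -/
theorem dSym_zero_zero (μ : Fin d) : dSym n (0 : Fin d → Fin n) (0 : Fin d → ℝ) μ = 0 := by
  simp [dSym, shiftr]

include hn in
/-- ★ A DEGENERATE COSET (`s″ = 0`, i.e. `ω^n` is a unit-lattice character there): the block is B5's `p′ = 0`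
fiber `Δ + aQ*Q = diag(Δ(l) + a[l = 0])`, shifted by `m̄`. [cite: Balaban1984PropagatorsI, (1.73)-(1.74) p.30, p.23] -/
theorem DaTw_twistOf_apply_of_eq (q : Tor M) (h0 : reS n M φ q = 0) (i j : (Fin d → Fin n) × Fin d) :
    DaTw n M a (twistOf φ) q i j
      = Da₀ (d := d) (fun _ : Fin d => (0 : Fin n)) a (fun k => DeltaXir n 0 (shiftr n k 0))
          (shiftEquiv n (mbarQ n M φ q) i) (shiftEquiv n (mbarQ n M φ q) j) := by
  have hz : (fun _ : Fin d => (0 : Fin n)) = 0 := rfl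
  rw [Da₀_eq, Matrix.diagonal_apply, hz]
  simp only [EmbeddingLike.apply_eq_iff_eq]
  simp only [DaTw, ssymTw_twistOf_re, lsymTw_twistOf_re, uTw_twistOf_re, vTw_twistOf_re, h0,
    uSym_vSym_zero n hn, shiftEquiv_apply]
  by_cases hi : i.1 + mbarQ n M φ q = 0
  · have hd : dSym n (i.1 + mbarQ n M φ q) (0 : Fin d → ℝ) i.2 = 0 := by
      rw [hi]
      exact dSym_zero_zero n i.2
    by_cases hj : j.1 + mbarQ n M φ q = 0
    · have h1 : i.1 = j.1 := add_right_cancel (hi.trans hj.symm)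
      by_cases h2 : i.2 = j.2
      · have hij : i = j := Prod.ext h1 h2
        subst hij
        simp only [if_true, if_pos hi, hd, zero_mul, sub_zero, map_one, mul_one]
      · have hij : i ≠ j := fun h => h2 (congrArg Prod.snd h)
        simp only [if_neg hij, if_neg h2, hd, zero_mul, sub_zero, add_zero]
    · have hij : i ≠ j := fun h => hj (h ▸ hi)
      simp only [if_neg hij, if_neg hj, hd, zero_mul, mul_zero, sub_zero, ite_self, add_zero]
  · have hu : uSym n (i.1 + mbarQ n M φ q) (0 : Fin d → ℝ) = 0 := by
      rw [uSym_zero n hn, if_neg hi]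
    by_cases hij : i = j
    · subst hij
      simp only [if_true, if_neg hi, hu, map_zero, mul_zero, zero_mul, sub_zero, ite_self, add_zero]
    · simp only [if_neg hij, if_neg hi, hu, map_zero, mul_zero, zero_mul, sub_zero, ite_self, add_zero]

/-- the block as a shifted matrix, `s″ ≠ 0`. [cite: Balaban1984PropagatorsI, (1.73) p.30] -/
theorem DaTw_twistOf_eq_of_ne (q : Tor M) (h0 : reS n M φ q ≠ 0) :
    DaTw n M a (twistOf φ) q
      = (Da (balabanFiber n hn a ha (reS n M φ q) (abs_reS_le n M φ q) h0)).submatrix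
          (shiftEquiv n (mbarQ n M φ q)) (shiftEquiv n (mbarQ n M φ q)) :=
  Matrix.ext fun i j => DaTw_twistOf_apply_of_ne n hn M a ha φ q h0 i j

include hn in
/-- the block as a shifted matrix, `s″ = 0`. [cite: Balaban1984PropagatorsI, (1.73)-(1.74) p.30] -/
theorem DaTw_twistOf_eq_of_eq (q : Tor M) (h0 : reS n M φ q = 0) :
    DaTw n M a (twistOf φ) q
      = (Da₀ (d := d) (fun _ : Fin d => (0 : Fin n)) a (fun k => DeltaXir n 0 (shiftr n k 0))).submatrix
          (shiftEquiv n (mbarQ n M φ q)) (shiftEquiv n (mbarQ n M φ q)) :=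
  Matrix.ext fun i j => DaTw_twistOf_apply_of_eq n hn M a φ q h0 i j

/-- THE INVERSE BLOCKS AT A UNIT TWIST: (1.83) at `s″` (`balabanFiber … .G`), resp. B5's `p′ = 0` block `G₀`,
shifted by `m̄`. [cite: Balaban1984PropagatorsI, (1.83) p.31] -/
def GTw (q : Tor M) : Matrix ((Fin d → Fin n) × Fin d) ((Fin d → Fin n) × Fin d) ℂ :=
  if h : reS n M φ q = 0 then
    (G₀ (d := d) (fun _ : Fin d => (0 : Fin n)) a (fun k => DeltaXir n 0 (shiftr n k 0))).submatrix
      (shiftEquiv n (mbarQ n M φ q)) (shiftEquiv n (mbarQ n M φ q))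
  else
    ((balabanFiber n hn a ha (reS n M φ q) (abs_reS_le n M φ q) h).G).submatrix
      (shiftEquiv n (mbarQ n M φ q)) (shiftEquiv n (mbarQ n M φ q))

/-- `Δ(l) ≠ 0` for `l ≠ 0` at `p′ = 0`. [cite: Balaban1984PropagatorsI, (1.31) p.23] -/
theorem Delta_shift_ne_zero (k : Fin d → Fin n) (hk : k ≠ fun _ => 0) :
    DeltaXir n 0 (shiftr n k (0 : Fin d → ℝ)) ≠ 0 := by
  have hs : ∀ μ, |(0 : Fin d → ℝ) μ| ≤ Real.pi := fun μ => by simp [Real.pi_pos.le]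
  exact (lt_of_lt_of_le (by norm_num) (DeltaXir_shift_ge_four n k hk 0 hs)).ne'

/-- ★ `DaTw · GTw = 1` on every coset ((1.73)·(1.83) = 1 at `s″`, resp. at `p′ = 0`, shifted).
[cite: Balaban1984PropagatorsI, (1.71) p.30, (1.83) p.31] -/
theorem DaTw_mul_GTw (q : Tor M) : DaTw n M a (twistOf φ) q * GTw n hn M a ha φ q = 1 := by
  by_cases h0 : reS n M φ q = 0
  · rw [GTw, dif_pos h0, DaTw_twistOf_eq_of_eq n hn M a φ q h0, Matrix.submatrix_mul_equiv,
      Da₀_mul_G₀ (d := d) (fun _ : Fin d => (0 : Fin n)) ha.ne' (Δ := fun k => DeltaXir n 0 (shiftr n k 0))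
        (Delta_zero_zero n) (Delta_shift_ne_zero n), Matrix.submatrix_one_equiv]
  · rw [GTw, dif_neg h0, DaTw_twistOf_eq_of_ne n hn M a ha φ q h0, Matrix.submatrix_mul_equiv,
      Da_mul_G_balaban, Matrix.submatrix_one_equiv]

omit hM in
/-- `GTw ≥ 0` on every coset. [cite: Balaban1984PropagatorsI, (1.90) p.33] -/
theorem GTw_posSemidef (q : Tor M) : (GTw n hn M a ha φ q).PosSemidef := by
  by_cases h0 : reS n M φ q = 0
  · rw [GTw, dif_pos h0]
    refine Matrix.PosSemidef.submatrix ?_ _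
    have hΔ : ∀ k : Fin d → Fin n, 0 ≤ DeltaXir n 0 (shiftr n k (0 : Fin d → ℝ)) := fun k => by
      rw [Delta_eq n k 0]
      exact Finset.sum_nonneg fun μ _ => by positivity
    have hD := Da₀_posSemidef (d := d) (fun _ : Fin d => (0 : Fin n)) ha.le hΔ
    have hinv : (Da₀ (d := d) (fun _ : Fin d => (0 : Fin n)) a (fun k => DeltaXir n 0 (shiftr n k 0)))⁻¹
        = G₀ (d := d) (fun _ : Fin d => (0 : Fin n)) a (fun k => DeltaXir n 0 (shiftr n k 0)) :=
      Matrix.inv_eq_right_inv (Da₀_mul_G₀ (d := d) (fun _ : Fin d => (0 : Fin n)) ha.ne'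
        (Δ := fun k => DeltaXir n 0 (shiftr n k 0)) (Delta_zero_zero n) (Delta_shift_ne_zero n))
    rw [← hinv]
    exact hD.inv
  · rw [GTw, dif_neg h0]
    exact (G_posSemidef _ (fun k => Delta_eq n k _)).submatrix _

/-- the flat weights of (1.89) at a momentum `s`: `1` and `∂_ν(s + ·)`. [cite: Balaban1984PropagatorsI, Prop. 1.1 (1.89) p.33] -/
def wFl : Option (Fin d) → (Fin d → ℝ) → (Fin d → Fin n) → ℂ
  | none => fun _ _ => 1
  | some ν => fun s k => dSym n k s ν

/-- the derivative order of a weight. [cite: Balaban1984PropagatorsI, Prop. 1.1 (1.89) p.33] -/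
def ordOf : Option (Fin d) → ℕ
  | none => 0
  | some _ => 1

/-- two weights have total order `≤ 2`. [cite: Balaban1984PropagatorsI, Prop. 1.1 (1.89) p.33] -/
theorem ordOf_add_le (α β : Option (Fin d)) : ordOf (d := d) α + ordOf (d := d) β ≤ 2 := by
  cases α <;> cases β <;> simp [ordOf]

omit [NeZero n] in
/-- the weights are admissible of their order. [cite: Balaban1984PropagatorsI, Prop. 1.1 (1.89) p.33] -/
theorem wFl_order (α : Option (Fin d)) (s : Fin d → ℝ) (k : Fin d → Fin n) :
    ‖wFl n α s k‖ ^ 2 ≤ DeltaXir n 0 (shiftr n k s) ^ ordOf (d := d) α := by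
  cases α with
  | none => simp [wFl, ordOf]
  | some ν => exact weight_order_one n s ν k

/-- the twisted weights are the flat ones at `(s″, l + m̄)`. [cite: Balaban1984PropagatorsI, Prop. 1.1 (1.89) p.33] -/
theorem wTw_twistOf_re (α : Option (Fin d)) (q : Tor M) (k : Fin d → Fin n) :
    wTw n M (twistOf φ) α q k = wFl n α (reS n M φ q) (k + mbarQ n M φ q) := by
  cases α with
  | none => rfl
  | some ν => exact ssymTw_twistOf_re n M φ k q ν

/-- ★ THE FOUR (1.89) SANDWICH BOUNDS FOR THE TWISTED INVERSE BLOCKS, every coset, every `φ`: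
`‖D_{w_α} GTw(p′) D_{w_β}^*‖ ≤ Cst(d,a)`. [cite: Balaban1984PropagatorsI, Prop. 1.1 (1.89) p.33] -/
theorem GTw_sandwich_le (q : Tor M) (α β : Option (Fin d)) :
    ‖sandwich (wTw n M (twistOf φ) α q) (wTw n M (twistOf φ) β q) (GTw n hn M a ha φ q)‖ ≤ Cst d a := by
  have hw : ∀ γ, wTw n M (twistOf φ) γ q = fun k => wFl n γ (reS n M φ q) (k + mbarQ n M φ q) :=
    fun γ => funext fun k => wTw_twistOf_re n M φ γ q k
  rw [hw α, hw β]
  by_cases h0 : reS n M φ q = 0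
  · rw [GTw, dif_pos h0, sandwich_submatrix, norm_submatrix_shiftEquiv, h0]
    exact (opNorm_sandwich_G₀_le_of_orders n a ha (ordOf_add_le α β) (wFl_order n α 0)
      (wFl_order n β 0)).trans (le_max_right _ _)
  · rw [GTw, dif_neg h0, sandwich_submatrix, norm_submatrix_shiftEquiv]
    exact (opNorm_sandwich_G_le_of_orders n hn a ha _ _ h0 (ordOf_add_le α β) (wFl_order n α _)
      (wFl_order n β _)).trans (le_max_left _ _)

/-! ## §5 The twisted (1.90), unconditionally -/

/-- `Δ^{e^{iφ}}_a · blockOp GTw = 1`. [cite: Balaban1984PropagatorsI, (1.71) p.30, (1.83) p.31] -/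
theorem DeltaATw_mul_blockOp_GTw :
    DeltaATw n M a (twistOf φ) * blockOp n M (GTw n hn M a ha φ) = 1 := by
  rw [DeltaATw_eq_blockOp, blockOp_mul]
  have h : (fun q => DaTw n M a (twistOf φ) q * GTw n hn M a ha φ q) = 1 :=
    funext fun q => DaTw_mul_GTw n hn M a ha φ q
  rw [h]
  exact blockOp_one n M

include hn ha in
/-- ★★★ **THE TWISTED (1.90) AS A FORM INEQUALITY, EVERY UNIT TWIST** (twin of
`B5Eq190FlatCoercivityUniform.b05_form_lower` at the constant abelian background `ω = e^{iφ}`): for `n ≥ 1`, `a > 0`,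
every volume `M` and every `φ ∈ ℝ^d`, `(1/((d+1)·Cst(d,a)))·Σ_w‖A w‖² ≤ re⟨A, Δ^ω_aA⟩` — same volume-free constant.
[cite: Balaban1984PropagatorsI, Prop. 1.1 (1.90) p.33; Balaban1985BackgroundPropagators, (3.26) p.395, Thm 3.11 p.416] -/
theorem b05Tw_form_lower_twistOf (A : Tor (fine n M) × Fin d → ℂ) :
    (1 / ((d + 1 : ℝ) * Cst d a)) * ∑ w, ‖A w‖ ^ 2
      ≤ (star A ⬝ᵥ (DeltaATw n M a (twistOf φ) *ᵥ A)).re :=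
  b05Tw_form_lower n M a (twistOf φ) (GTw n hn M a ha φ) (DeltaATw_mul_blockOp_GTw n hn M a ha φ)
    (GTw_posSemidef n hn M a ha φ) (GTw_sandwich_le n hn M a ha φ) A

include hn ha in
/-- RECOVERY (`φ = 0`): the flat (1.90) `B5Eq190FlatCoercivityUniform.b05_form_lower`, re-derived through the
twisted road. [cite: Balaban1984PropagatorsI, Prop. 1.1 (1.90) p.33] -/
theorem b05_form_lower_recovered (A : Tor (fine n M) × Fin d → ℂ) :
    (1 / ((d + 1 : ℝ) * Cst d a)) * ∑ w, ‖A w‖ ^ 2 ≤ (star A ⬝ᵥ (DeltaA n M a *ᵥ A)).re := by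
  have h := b05Tw_form_lower_twistOf n hn M a ha 0 A
  rwa [twistOf_zero, DeltaATw_one] at h

end Fibers

end

end Literature.MathematicalPhysics.QuantumFieldTheory.Balaban1983to89.B5ToronEq190UnitTwist
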